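import Summits.HodgeConjecture.HodgeConjecture.Theorems.NikulinTwinTransportRealMultiplicationCore
import Summits.HodgeConjecture.HodgeConjecture.Theorems.NikulinTwinTransportRealMultiplicationGForm
import Summits.HodgeConjecture.HodgeConjecture.Theorems.NikulinTwinTransportRealMultiplicationHodgeTypes
import Summits.HodgeConjecture.HodgeConjecture.Theorems.NikulinTwinTransportRealMultiplicationSqrtTwoAlgebraic

/-!
# Route NikulinTwinTransport · crux `TwinTransportRMPicardTwo` (stmt-HodgeConjecture-15067) —
# real multiplication by `√2` is cup-self-adjoint (Zarhin's theorem on the real carriers)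

The judge's milestone `TwinTransportRMPicardTwo` and the route's deliverable
`RealMultiplicationSqrtTwoAlgebraic` (stmt-HodgeConjecture-13679) both speak of a rational,
type-preserving endomorphism `e` of `H²(S(ℂ); ℂ)` of a projective K3 surface `S` that kills
`N := algebraicClasses S 1` and satisfies `e (e x) = 2x` for `x ⊥ N` — real multiplication by
`√2` on `T(S) = N^⊥`. The deliverable ASSUMES in addition that `e` is self-adjoint for the cup
product, the milestone deliberately does not ("Zarhin makes `√2` self-adjoint" — in print, Zarhin
1983, Thm. 1.5.1: on the irreducible Hodge structure `T(S)_ℚ` of K3 type the adjoint of a Hodge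
endomorphism is its complex conjugate for the embedding given by the action on `H^{2,0}`, and
`±√2` is real). This file proves that self-adjointness on the real carriers, so that the two
items speak about the same endomorphisms:

* `selfAdjoint_of_sq_eq_two` — the linear algebra over any field: `β` symmetric non-degenerate
  on a finite-dimensional `W`, `N ≤ W`, `ε` killing `N` with `ε² = 2` on `N^⊥`, `f` the
  `β`-adjoint of `ε`; if some additive "period functional" `ℓ` with `ker ℓ ⊆ N` intertwines
  BOTH `ε` and `f` with one and the same map `L` (`ℓ ∘ ε = L ∘ ℓ`, `ℓ ∘ f = L ∘ ℓ`), then `ε` is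
  `β`-self-adjoint. (`f - ε` has image in `ker ℓ ⊆ N`; pairing against `N^⊥` and `β`-symmetry
  give `f = ε` on `N^⊥`, whence `ε N^⊥ ⊆ N^⊥`; `N ∩ N^⊥ = 0` because `ε` is `0` and `ε²` is
  `2` there; so `W = N ⊕ N^⊥` and `β(εu, v) = β(u, εv)` follows by decomposing `u`, `v`.)
* `conj_eq_self_of_mul_self_eq_two` — a complex number with `t² = 2` is real.
* `realMultiplication_selfAdjoint` — the K3 statement: granted the three named facts
  `Huybrechts_K3_marking_exists`, `Huybrechts_K3_hodgeTypes_H2`,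
  `Grothendieck1969_supportedClasses_le_hodgeConiveau` and the route's support item
  `LefschetzOneOneK3` (stmt-HodgeConjecture-13678: rational `(1,1)`-classes are algebraic), every
  rational, type-preserving `e` killing `N` with `e² = 2` on `N^⊥` is cup-self-adjoint. The
  period functional is `ℓ(u) = (u.x₀)` for a marking `η` with period `x₀ = η(σ)`: its kernel on
  `Λ_ℚ` consists of rational `(1,1)`-classes (Huybrechts' description of the Hodge types), which
  are algebraic by Lefschetz `(1,1)`; `ℓ(εu) = t ℓ(u)` where `eσ̄ = tσ̄` (decompose
  `x = aσ + w + bσ̄`), `ℓ(fu) = t' ℓ(u)` where `eσ = t'σ` (adjunction), and `t = t̄' = t'`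
  because `e` commutes with complex conjugation (it is rational) and `t'² = 2` (`σ ⊥ N` since
  algebraic classes are of type `(1,1)`).

Used by the sibling file `NikulinTwinTransportTwinTransportRMPicardTwo` to derive the milestone
BY NAME from `RealMultiplicationSqrtTwoAlgebraic`. Prover seat
prover-HodgeConjecture-route-HodgeConjecture-NikulinTwinTransport-1.

## References

* [Zarhin1983] Yu. G. Zarhin, Hodge groups of K3 surfaces, J. reine angew. Math. 341 (1983),
  Thm. 1.5.1.
* [Huybrechts2016K3] D. Huybrechts, Lectures on K3 Surfaces, CUP 2016, Ch. 3 Cor. 3.3.6 and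
  Thm. 3.3.7, Ch. 6 Prop. 1.2.
* [VanGeemenSchuett2023] B. van Geemen, M. Schütt, arXiv:2310.05196, §2.1.
-/

noncomputable section

namespace Summit.HodgeConjecture.HodgeConjecture.Theorems.NikulinTwinTransport

open scoped Manifold
open CategoryTheory MonoidalCategory
open Literature.AlgebraicGeometry.Motives Literature.AlgebraicGeometry.HodgeTheory
open Literature.AlgebraicGeometry.Surfaces Literature.Geometry.Kaehler
open Literature.AlgebraicTopology.SingularHomology

/-! ### The linear algebra -/

section Abstract

variable {K : Type*} [Field K] {W : Type*} [AddCommGroup W] [Module K W] [FiniteDimensional K W]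
  {C : Type*} [AddCommGroup C] [Module K C]

/-- **Self-adjointness of real multiplication from a period functional.** Let `β` be a symmetric
non-degenerate bilinear form on a finite-dimensional space `W` over a field with `2 ≠ 0`,
`N ≤ W`, `ε` an endomorphism killing `N` with `ε(εt) = 2t` for `t ∈ N^⊥`, and `f` a `β`-adjoint
of `ε` (`β(fx, y) = β(x, εy)`). Suppose an additive `ℓ : W → C` with `ker ℓ ⊆ N` satisfies
`ℓ(εu) = L(ℓ u)` and `ℓ(fu) = L(ℓ u)` for one map `L`. Then `β(εu, v) = β(u, εv)` for all
`u, v`. Proof: `f - ε` maps into `ker ℓ ⊆ N`; pairing with `N^⊥` and symmetry give `f = ε` on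
`N^⊥`, so `ε N^⊥ ⊆ N^⊥`; `N ∩ N^⊥ = 0` (`ε = 0` and `ε² = 2` there), hence `W = N ⊕ N^⊥`, and
the identity follows by decomposing `u` and `v`. [cite: Zarhin1983, Thm. 1.5.1 (the statement
being abstracted)] -/
theorem selfAdjoint_of_sq_eq_two [NeZero (2 : K)] {β : LinearMap.BilinForm K W} (hβs : β.IsSymm)
    (hβn : β.Nondegenerate) (N : Submodule K W) (ε f : W →ₗ[K] W)
    (hf : ∀ x y, β (f x) y = β x (ε y))
    (hN : ∀ n ∈ N, ε n = 0) (hT : ∀ t ∈ β.orthogonal N, ε (ε t) = (2 : K) • t)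
    (ℓ : W →ₗ[K] C) (L : C → C) (hker : ∀ u, ℓ u = 0 → u ∈ N)
    (hℓε : ∀ u, ℓ (ε u) = L (ℓ u)) (hℓf : ∀ u, ℓ (f u) = L (ℓ u)) :
    ∀ u v, β (ε u) v = β u (ε v) := by
  have hsym : ∀ x y, β x y = β y x := fun x y => hβs.eq x y
  have horth : ∀ t ∈ β.orthogonal N, ∀ n ∈ N, β n t = 0 := fun t ht n hn =>
    (LinearMap.BilinForm.mem_orthogonal_iff.1 ht) n hn
  -- (1) `f - ε` has image in `N`
  have hd : ∀ u, f u - ε u ∈ N := fun u =>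
    hker _ (by rw [map_sub, hℓf, hℓε, sub_self])
  -- (2) `f = ε` on `N^⊥`
  have hfT : ∀ t ∈ β.orthogonal N, f t = ε t := by
    intro t ht
    rw [← sub_eq_zero]
    refine hβn.1 _ fun y => ?_
    have h2 : β t (f y - ε y) = 0 := by rw [hsym, horth t ht _ (hd y)]
    rw [map_sub] at h2
    rw [sub_eq_zero] at h2
    have h3 : β (ε t) y = β t (f y) := by rw [hsym (ε t) y, ← hf y t, hsym (f y) t]
    rw [map_sub, LinearMap.sub_apply, hf t y, h3, h2, sub_self]
  -- (3) `ε N^⊥ ⊆ N^⊥`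
  have hεT : ∀ t ∈ β.orthogonal N, ε t ∈ β.orthogonal N := by
    intro t ht
    rw [LinearMap.BilinForm.mem_orthogonal_iff]
    intro n hn
    show β n (ε t) = 0
    rw [← hfT t ht, hsym, hf, hN n hn, map_zero]
  -- (4) `N ∩ N^⊥ = 0`, so `W = N ⊕ N^⊥`
  have hNT : ∀ r ∈ N, r ∈ β.orthogonal N → r = 0 := by
    intro r hrN hrT
    have h := hT r hrT
    rw [hN r hrN, map_zero] at h
    exact (smul_eq_zero.1 h.symm).resolve_left (NeZero.ne 2)
  have hcompl : IsCompl N (β.orthogonal N) := by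
    refine LinearMap.BilinForm.isCompl_orthogonal_of_restrict_nondegenerate hβs.isRefl ?_
    have hrefl : (β.restrict N).IsRefl := fun x y h => by
      change β (x : W) (y : W) = 0 at h
      change β (y : W) (x : W) = 0
      rwa [hsym]
    refine (LinearMap.IsRefl.nondegenerate_iff_separatingLeft hrefl).2 fun x hx => ?_
    have hxT : (x : W) ∈ β.orthogonal N := by
      rw [LinearMap.BilinForm.mem_orthogonal_iff]
      intro n hn
      show β n (x : W) = 0
      have := hx ⟨n, hn⟩
      change β (x : W) n = 0 at this
      rwa [hsym]
    exact Subtype.ext (hNT x x.2 hxT)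
  have hdec : ∀ y : W, ∃ n ∈ N, ∃ t ∈ β.orthogonal N, y = n + t := fun y => by
    have hy : y ∈ N ⊔ β.orthogonal N := by rw [hcompl.sup_eq_top]; exact Submodule.mem_top
    obtain ⟨n, hn, t, ht, hnt⟩ := Submodule.mem_sup.1 hy
    exact ⟨n, hn, t, ht, hnt.symm⟩
  -- (5) conclude
  intro u v
  obtain ⟨n, hn, t, ht, rfl⟩ := hdec u
  obtain ⟨n', hn', t', ht', rfl⟩ := hdec v
  have hεv : ε (n' + t') = ε t' := by rw [map_add, hN n' hn', zero_add]
  have hεu : ε (n + t) = ε t := by rw [map_add, hN n hn, zero_add]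
  have hnt : β n (ε t') = 0 := horth _ (hεT t' ht') n hn
  rw [hεu, hεv, ← hfT t ht, hf, hεv, map_add β, LinearMap.add_apply, hnt, zero_add]

end Abstract

/-- A complex number with `t · t = 2` is real (`t = ±√2`). [folklore] -/
theorem conj_eq_self_of_mul_self_eq_two {t : ℂ} (h : t * t = 2) : starRingEnd ℂ t = t := by
  rw [Complex.conj_eq_iff_im]
  have hre : t.re * t.re - t.im * t.im = 2 := by
    have := congrArg Complex.re h
    simpa [Complex.mul_re] using this
  have him : t.re * t.im + t.im * t.re = 0 := by
    have := congrArg Complex.im h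
    simpa [Complex.mul_im] using this
  by_contra hne
  have hre0 : t.re = 0 := by
    have h2 : t.re * t.im = 0 := by linarith
    exact (mul_eq_zero.1 h2).resolve_right hne
  rw [hre0] at hre
  nlinarith [mul_self_nonneg t.im]

/-! ### Real multiplication on a projective K3 surface is cup-self-adjoint -/

/-- `Λ_ℚ ⊂ Λ_ℂ` takes the rational standard basis vector to the integral one (both are
`i ↦ [i = j]`). [folklore] -/
theorem ratCastΛ_single (j : K3Index) :
    (fun i => ((Pi.single j (1 : ℚ) : K3Index → ℚ) i : ℂ)) =
      fun i => ((Pi.single j (1 : ℤ) : K3Index → ℤ) i : ℂ) := by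
  classical
  funext i
  by_cases hij : i = j
  · subst hij; simp only [Pi.single_eq_same, Rat.cast_one, Int.cast_one]
  · simp only [Pi.single_apply, if_neg hij, Rat.cast_zero, Int.cast_zero]

/-- The pairing of `Λ_ℂ` against a rational vector, expanded in the standard basis:
`(u.z) = Σⱼ (u.eⱼ) zⱼ`. [folklore] -/
theorem k3Form_ratCast_eq_sum (u : K3Index → ℚ) (z : K3Index → ℂ) :
    k3Form (fun i => (u i : ℂ)) z = ∑ j, z j * ((k3FormRat u (Pi.single j 1) : ℚ) : ℂ) := by
  classical
  conv_lhs => rw [pi_eq_sum_single z]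
  rw [← k3FormC_apply, map_sum]
  refine Finset.sum_congr rfl fun j _ => ?_
  rw [map_smul, smul_eq_mul, k3FormC_apply, ← ratCastΛ_single, k3Form_ratCast]

variable {S : SchemeOver ℂ}

/-- **Real multiplication by `√2` on a projective K3 surface is cup-self-adjoint** (Zarhin's
theorem, Thm. 1.5.1, on the real carriers for the element `√2`): granted the named facts
`Huybrechts_K3_marking_exists`, `Huybrechts_K3_hodgeTypes_H2`,
`Grothendieck1969_supportedClasses_le_hodgeConiveau` and the route's support item
`LefschetzOneOneK3` (rational `(1,1)`-classes on a projective K3 surface are algebraic), every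
rational, type-preserving endomorphism `e` of `H²(S(ℂ); ℂ)` killing `N := algebraicClasses S 1`
with `e (e x) = 2x` for `x ⊥ N` satisfies `(ex.y) = (x.ey)`. Proof: read `e` through a marking
`η` as a rational `ε` on `Λ_ℚ` and apply `selfAdjoint_of_sq_eq_two` with the rational K3 form,
`N_ℚ`, the `ℚ`-adjoint of `ε` and the period functional `ℓ(u) = (u.x₀)`, `x₀ = η σ`: its kernel
consists of rational `(1,1)`-classes (Huybrechts Ch. 6 Prop. 1.2), algebraic by Lefschetz
`(1,1)`; `ℓ ∘ ε = t ℓ` with `eσ̄ = tσ̄` (decompose `x = aσ + w + bσ̄`), `ℓ ∘ ε† = t' ℓ` with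
`eσ = t'σ`, and `t = conj t' = t'` since `e` commutes with conjugation and `t'² = 2` (`σ ⊥ N`,
algebraic classes being of type `(1,1)`). [cite: Zarhin1983, Thm. 1.5.1]
[cite: Huybrechts2016K3, Ch. 3 Thm. 3.3.7 and Ch. 6 Prop. 1.2] [cite: VanGeemenSchuett2023, §2.1] -/
theorem realMultiplication_selfAdjoint
    (hmark : Huybrechts_K3_marking_exists) (hHT : Huybrechts_K3_hodgeTypes_H2)
    (hG : Grothendieck1969_supportedClasses_le_hodgeConiveau)
    (hL : Theses.NikulinTwinTransport.LefschetzOneOneK3) (hS : IsK3Surface S)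
    (e : complexBetti S (2 * 1) →ₗ[ℂ] complexBetti S (2 * 1))
    (he_rat : ∀ x, IsRationalClass x → IsRationalClass (e x))
    (he_type : ∀ (i j : ℕ) x, IsOfHodgeType 2 S (2 * 1) i j x → IsOfHodgeType 2 S (2 * 1) i j (e x))
    (he_N : ∀ d ∈ algebraicClasses S 1, e d = 0)
    (he_T : ∀ x : complexBetti S (2 * 1),
      (∀ d ∈ algebraicClasses S 1, cupProduct (rfl : 2 * 1 + 2 * 1 = 2 * 2) x d = 0) →
        e (e x) = (2 : ℂ) • x) :
    ∀ x y : complexBetti S (2 * 1),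
      cupProduct (rfl : 2 * 1 + 2 * 1 = 2 * 2) (e x) y =
        cupProduct (rfl : 2 * 1 + 2 * 1 = 2 * 2) x (e y) := by
  classical
  set N := algebraicClasses S 1 with hNdef
  -- a marking, its period `x₀ = η σ`, the Hodge types of `H²(S)`
  obtain ⟨η, p₀, x₀, hp₀, ⟨-, -, hηint, hηcup, h20, -⟩, ⟨hx00, hxpos, -⟩⟩ := hmark S hS
  have hσ0 : η.symm x₀ ≠ 0 := fun h0 =>
    ne_zero_of_star_self_re_pos hxpos (by simpa using congrArg η h0)
  obtain ⟨h1, h2, h3⟩ := hHT S hS (η.symm x₀) h20 hσ0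
  rw [conjClass_marking_symm η hηint] at h2 h3
  obtain ⟨A⟩ := hS.nonempty_hodgeModel
  have hsmul : ∀ {c c' : ℂ}, c • p₀ = c' • p₀ → c = c' := fun h => smul_left_injective ℂ hp₀ h
  -- the period functional `φ y = (η y . x₀)` on `H²(S)`; it kills the `(1,1)`-classes
  have hφ11 : ∀ w, IsOfHodgeType 2 S (2 * 1) 1 1 w → k3Form (η w) x₀ = 0 := by
    intro w hw
    have h := ((h3 w).1 hw).1
    rw [hηcup, LinearEquiv.apply_symm_apply, smul_eq_zero] at h
    exact h.resolve_right hp₀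
  -- `σ ⊥ N` (algebraic classes are of type `(1,1)`), so `e (e σ) = 2 σ`
  have hN11 : ∀ d ∈ N, IsOfHodgeType 2 S (2 * 1) 1 1 d :=
    fun d hd => isOfHodgeType_oneOne_of_mem_algebraicClasses hG hS hd
  have hσN : ∀ d ∈ N, cupProduct (rfl : 2 * 1 + 2 * 1 = 2 * 2) (η.symm x₀) d = 0 := by
    intro d hd
    have h := ((h3 d).1 (hN11 d hd)).1
    rw [hηcup] at h ⊢
    rwa [k3Form_comm]
  -- `e σ = t σ` with `t² = 2`, hence `t` real, and `e σ̄ = t σ̄`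
  obtain ⟨t, ht⟩ := (h1 _).1 (he_type 2 0 _ h20)
  have htt : t * t = 2 := by
    have h := he_T _ hσN
    rw [ht, map_smul, ht, smul_smul] at h
    exact smul_left_injective ℂ hσ0 h
  have htreal : starRingEnd ℂ t = t := conj_eq_self_of_mul_self_eq_two htt
  have htbar : e (η.symm (star x₀)) = t • η.symm (star x₀) := by
    have h := conjClass_apply_of_isRationalClass η hηint e he_rat (η.symm x₀)
    rw [ht, conjClass_smul, htreal, conjClass_marking_symm η hηint] at h
    exact h.symm
  -- `(η (e x) . x₀) = t (η x . x₀)` for every class `x` (decompose `x = aσ + w + bσ̄`)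
  have hP : ∀ x, k3Form (η (e x)) x₀ = t * k3Form (η x) x₀ := by
    intro x
    obtain ⟨a, b, w, hw, hx⟩ := exists_eq_lines_add_oneOne hS.1 A h1 h2 x
    have hex : e x = (a * t) • η.symm x₀ + e w + (b * t) • η.symm (star x₀) := by
      rw [hx, map_add, map_add, map_smul, map_smul, ht, htbar, smul_smul, smul_smul]
    rw [hex, hx]
    simp only [map_add, map_smul, LinearEquiv.apply_symm_apply, k3Form_add_left,
      k3Form_smul_left, hx00, hφ11 w hw, hφ11 (e w) (he_type 1 1 w hw)]
    ring
  -- read `e` through the marking: a rational `ε` on `Λ_ℚ`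
  obtain ⟨ε, hε⟩ := exists_ratEnd_of_forall_intCast (η.toLinearMap ∘ₗ e ∘ₗ η.symm.toLinearMap)
    (markingConj_intCast hS η hηint η hηint e he_rat)
  have hε' : ∀ u : K3Index → ℚ, η (e (η.symm fun j => (u j : ℂ))) = fun j => (ε u j : ℂ) :=
    fun u => by
    simpa only [LinearMap.coe_comp, LinearEquiv.coe_coe, Function.comp_apply] using hε u
  have hεx : ∀ u : K3Index → ℚ, e (η.symm fun j => (u j : ℂ)) = η.symm fun j => (ε u j : ℂ) :=
    fun u => by rw [← hε' u, LinearEquiv.symm_apply_apply]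
  -- the rational points of `N`
  let NQ : Submodule ℚ (K3Index → ℚ) :=
    { carrier := {u | η.symm (fun j => (u j : ℂ)) ∈ N}
      add_mem' := fun {u v} hu hv => by
        simp only [Set.mem_setOf_eq, ratCastΛ_add, map_add]
        exact N.add_mem hu hv
      zero_mem' := by
        simp only [Set.mem_setOf_eq, ratCastΛ_zero, map_zero]
        exact N.zero_mem
      smul_mem' := fun q u hu => by
        simp only [Set.mem_setOf_eq, ratCastΛ_smul, map_smul]
        exact N.smul_mem _ hu }
  have memNQ : ∀ u, u ∈ NQ ↔ η.symm (fun j => (u j : ℂ)) ∈ N := fun u => Iff.rfl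
  -- (N) `ε` kills `N_ℚ`
  have hNQ : ∀ u ∈ NQ, ε u = 0 := by
    intro u hu
    apply ratCastΛ_injective
    rw [← hε' u, he_N _ ((memNQ u).1 hu), map_zero, ratCastΛ_zero]
  -- `N` is spanned by its rational classes, so `N_ℚ^⊥ ⊗ ℂ ⊆ N^⊥`
  have hspan := span_isRationalClass_eq_top_of_isSmoothProjective_holds.supportedClasses_eq_span
    hS.1 (2 * 1) 1
  have horth : ∀ u ∈ k3FormRat.orthogonal NQ, ∀ d ∈ N, k3Form (fun j => (u j : ℂ)) (η d) = 0 := by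
    intro u hu d hd
    rw [LinearMap.BilinForm.mem_orthogonal_iff] at hu
    have hd' : d ∈ Submodule.span ℂ {c : complexBetti S (2 * 1) |
        IsRationalClass c ∧ c ∈ supportedClasses S (2 * 1) 1} := by
      rw [← hspan]; exact hd
    clear hd
    induction hd' using Submodule.span_induction with
    | mem d hd =>
      obtain ⟨w, hw⟩ := (isRationalClass_iff_of_marking hS η hηint d).1 hd.1
      have hwN : w ∈ NQ := by
        rw [memNQ, ← hw, LinearEquiv.symm_apply_apply]
        exact hd.2
      rw [hw, k3Form_ratCast, k3FormRat_isSymm.eq, hu w hwN, Rat.cast_zero]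
    | zero => rw [map_zero, k3Form_zero_right]
    | add c c' _ _ hc hc' => rw [map_add, k3Form_add_right, hc, hc', add_zero]
    | smul r c _ hc => rw [map_smul, k3Form_smul_right, hc, mul_zero]
  -- (T) `ε² = 2` on `N_ℚ^⊥`
  have hTQ : ∀ u ∈ k3FormRat.orthogonal NQ, ε (ε u) = (2 : ℚ) • u := by
    intro u hu
    have hx : ∀ d ∈ algebraicClasses S 1,
        cupProduct (rfl : 2 * 1 + 2 * 1 = 2 * 2) (η.symm fun j => (u j : ℂ)) d = 0 := fun d hd => by
      rw [hηcup, LinearEquiv.apply_symm_apply, horth u hu d hd, zero_smul]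
    have h2 := he_T _ hx
    rw [hεx, hεx, ← LinearEquiv.map_smul, ← Rat.cast_ofNat, ← ratCastΛ_smul] at h2
    exact ratCastΛ_injective (η.symm.injective h2)
  -- the `ℚ`-adjoint `f` of `ε`
  set f := k3FormRat.leftAdjointOfNondegenerate k3FormRat_nondegenerate ε with hfdef
  have hf : ∀ x y, k3FormRat (f x) y = k3FormRat x (ε y) :=
    k3FormRat.isAdjointPairLeftAdjointOfNondegenerate k3FormRat_nondegenerate ε
  -- the period functional on `Λ_ℚ`: `ℓ u = (u . x₀)`, as a `ℚ`-linear map to `ℂ`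
  let ι : (K3Index → ℚ) →ₗ[ℚ] (K3Index → ℂ) :=
    { toFun := fun u j => (u j : ℂ)
      map_add' := ratCastΛ_add
      map_smul' := fun q u => by
        rw [ratCastΛ_smul, RingHom.id_apply, Rat.cast_smul_eq_qsmul] }
  let ℓ : (K3Index → ℚ) →ₗ[ℚ] ℂ := ((k3FormC.flip x₀).restrictScalars ℚ) ∘ₗ ι
  have hℓ : ∀ u, ℓ u = k3Form (fun j => (u j : ℂ)) x₀ := fun u => by
    simp only [ℓ, ι, LinearMap.coe_comp, Function.comp_apply, LinearMap.coe_restrictScalars,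
      LinearMap.coe_mk, AddHom.coe_mk, LinearMap.BilinForm.flip_apply, k3FormC_apply]
  -- `ker ℓ ⊆ N_ℚ`: rational classes orthogonal to `σ` are `(1,1)` and algebraic (Lefschetz)
  have hker : ∀ u, ℓ u = 0 → u ∈ NQ := by
    intro u hu
    rw [hℓ] at hu
    rw [memNQ]
    have hrat : IsRationalClass (η.symm fun j => (u j : ℂ)) :=
      (isRationalClass_iff_of_marking hS η hηint _).2 ⟨u, LinearEquiv.apply_symm_apply _ _⟩
    refine hL S hS _ hrat ((h3 _).2 ⟨?_, ?_⟩)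
    · rw [hηcup, LinearEquiv.apply_symm_apply, LinearEquiv.apply_symm_apply, hu, zero_smul]
    · rw [hηcup, LinearEquiv.apply_symm_apply, LinearEquiv.apply_symm_apply]
      have hreal : star (fun j => (u j : ℂ)) = fun j => (u j : ℂ) := by
        funext j
        show star ((u j : ℚ) : ℂ) = _
        rw [Complex.star_def, map_ratCast]
      have h : k3Form (fun j => (u j : ℂ)) (star x₀) = star (k3Form (fun j => (u j : ℂ)) x₀) := by
        rw [star_k3Form, hreal]
      rw [h, hu, star_zero, zero_smul]
  -- `ℓ (ε u) = t ℓ u`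
  have hℓε : ∀ u, ℓ (ε u) = t * ℓ u := by
    intro u
    rw [hℓ, hℓ, ← hε' u, hP, LinearEquiv.apply_symm_apply]
  -- `ℓ (f u) = t ℓ u`: expand `x₀` in the basis and use `η e η⁻¹ x₀ = t x₀`
  have hEx₀ : η (e (η.symm x₀)) = t • x₀ := by rw [ht, map_smul, LinearEquiv.apply_symm_apply]
  have hℓf : ∀ u, ℓ (f u) = t * ℓ u := by
    intro u
    rw [hℓ, hℓ, k3Form_ratCast_eq_sum]
    simp_rw [hf]
    -- `Σⱼ x₀ⱼ (u . ε eⱼ) = (u . η e η⁻¹ x₀) = t (u . x₀)`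
    have hx₀ : x₀ = ∑ j, x₀ j • fun i => ((Pi.single j (1 : ℚ) : K3Index → ℚ) i : ℂ) := by
      conv_lhs => rw [pi_eq_sum_single x₀]
      simp_rw [ratCastΛ_single]
    have hE : η (e (η.symm x₀)) = ∑ j, x₀ j • fun i => (ε (Pi.single j 1) i : ℂ) := by
      conv_lhs => rw [hx₀]
      rw [map_sum, map_sum, map_sum]
      refine Finset.sum_congr rfl fun j _ => ?_
      rw [map_smul, map_smul, map_smul, hε' (Pi.single j 1)]
    have key : k3Form (fun i => (u i : ℂ)) (η (e (η.symm x₀))) =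
        ∑ j, x₀ j * ((k3FormRat u (ε (Pi.single j 1)) : ℚ) : ℂ) := by
      rw [hE, ← k3FormC_apply, map_sum]
      refine Finset.sum_congr rfl fun j _ => ?_
      rw [map_smul, smul_eq_mul, k3FormC_apply, k3Form_ratCast]
    rw [← key, hEx₀, k3Form_smul_right]
  -- the abstract statement gives self-adjointness of `ε` for the rational K3 form
  have hadj : ∀ u v, k3FormRat (ε u) v = k3FormRat u (ε v) :=
    selfAdjoint_of_sq_eq_two k3FormRat_isSymm k3FormRat_nondegenerate NQ ε f hf hNQ hTQ ℓ
      (fun z => t * z) hker hℓε hℓf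
  -- transfer to `H²(S(ℂ); ℂ)`: both sides are bilinear and agree on the rational basis
  have hbil : k3FormC.compl₁₂ (η.toLinearMap ∘ₗ e) η.toLinearMap =
      k3FormC.compl₁₂ η.toLinearMap (η.toLinearMap ∘ₗ e) := by
    refine LinearMap.ext_basis ((Pi.basisFun ℂ K3Index).map η.symm)
      ((Pi.basisFun ℂ K3Index).map η.symm) fun i j => ?_
    simp only [Module.Basis.map_apply, basisFun_eq_ratCastΛ, LinearMap.compl₁₂_apply,
      LinearMap.coe_comp, LinearEquiv.coe_coe, Function.comp_apply,
      LinearEquiv.apply_symm_apply, k3FormC_apply, hε', k3Form_ratCast, hadj]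
  intro x y
  have h := LinearMap.congr_fun₂ hbil x y
  simp only [LinearMap.compl₁₂_apply, LinearMap.coe_comp, LinearEquiv.coe_coe,
    Function.comp_apply, k3FormC_apply] at h
  rw [hηcup, hηcup, h]

end Summit.HodgeConjecture.HodgeConjecture.Theorems.NikulinTwinTransport

end
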